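import Literature.Geometry.Lorentzian.CoordBianchiProjection
import HarnessLib

/-!
# `|∇f|² |Rm|² ≤ 16 |∇f|² |Ric|² + 64 |∇Ric|²` on four-dimensional gradient Ricci solitons

The pointwise algebra behind Munteanu–Wang 2015, Prop. 1.1 (p. 4: on a four-dimensional
gradient shrinking Ricci soliton `|Rm| ≤ c (|∇Ric|/√f + (|Ric|² + 1)/f + |Ric|)` outside a
compact set), in the coordinate tensor calculus of `CoordCurvature.lean` ff. (metric components
`G : E → (E →L E →L ℝ)`, `IsMetricOn G V`, curvature `riemAt`, Ricci form `ricAt`, `|Rm|² =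
rmNormSqAt`, `|Ric|² = normSqAt G x (ricAt G x)`, `|∇f|² = gradSqAt`, `∇Ric = cov₂At G (ricAt G)`,
metric pairing `pairAt`), in a form which avoids the level sets of `f`: Munteanu–Wang read the
curvature in a frame `{e₁, e₂, e₃, ν}`, `ν = ∇f/|∇f|`; the `3 × 3` block of `Rm` is controlled by
its three-dimensional Ricci contraction (the Weyl part of an algebraic curvature tensor vanishes
in dimension three), every component with a `ν`-slot is an `R(eᵢ, eⱼ, eₖ, ν)`, and on a gradient
soliton `R(X, Y, Z, ∇f) = (∇_X Ric)(Y, Z) − (∇_Y Ric)(X, Z)` (the last of the curvature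
identities recalled on p. 4, `R_{ijkl} f_l = ∇_j R_{ik} − ∇_i R_{jk}`; here
`IsMetricOn.cov₂At_ricAt_sub_of_soliton`). We prove

* `rm_sq_sum_le_fin_four` — the algebra over `Fin 4`: for `R : Fin 4 → Fin 4 → Fin 4 → Fin 4 → ℝ`
  skew in its first and in its last pair and pair-symmetric (the first Bianchi identity is not
  needed), `Σ_{ijkl} R_{ijkl}² ≤ 16 Σ_{ik} (Σ_j R_{jikj})² + 16 Σ_{ijk} R_{ijk3}²` (an explicit sum
  of squares in the `21` independent components; the sharp constant is `3 + 2√2`);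
* `exists_orthonormal_basis_last_eq`, `exists_orthonormal_basis_eq_smul_last` — a positive
  definite `G x` has an orthonormal basis whose last vector is a prescribed unit vector, resp. a
  prescribed multiple of any given vector (Mathlib's orthonormal extension, transported through an
  orthonormal basis of `(E, G x)`);
* **`IsMetricOn.gradSqAt_mul_rmNormSqAt_le_of_soliton`** — for metric components with
  `Ric + Hess f = λ G` on `V`, `dim E = 4` and `G x` positive definite:
  `|∇Ric|²_x = Σ_{kl} g^{kl} ⟨∇_{b_k} Ric, ∇_{b_l} Ric⟩ ≥ 0` (any basis `b`) and
  `|∇f|² |Rm|² ≤ 16 |∇f|² |Ric|² + 64 |∇Ric|²` at `x`: in a `G x`-orthonormal frame `e` adapted to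
  `♯Df = s e₃` (`s² = |∇f|²`), `s R(e_a,e_c,e_i,e₃) = (∇_{e_a}Ric)(e_c,e_i) − (∇_{e_c}Ric)(e_a,e_i)`,
  so `s² Σ_{aci} R(e_a,e_c,e_i,e₃)² ≤ 4 |∇Ric|²`, and `rm_sq_sum_le_fin_four` applies to the
  components `R_{acij} = G(R(e_a,e_c)e_i, e_j)` (`|Rm|² = Σ R_{acij}²`,
  `IsMetricOn.rmNormSqAt_eq_sum_sq`; `Ric(e_i,e_k) = Σ_j R_{jikj}`, `ricAt_eq_sum_of_orthonormal`).

Everything is proved; no definition and no statement of `Prop` type is introduced.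

## References

* O. Munteanu, J. Wang, *Geometry of shrinking Ricci solitons*, Compositio Math. 151 (2015)
  2273–2300 (arXiv:1410.3813), §1, Prop. 1.1 and the identities before it (p. 4).
  [MunteanuWang2015]
* M. Eminenti, G. La Nave, C. Mantegazza, *Ricci solitons: the equation point of view*,
  manuscripta math. 127 (2008), Prop. 2.1. [EminentiLanaveMantegazza2008]
* B. O'Neill, *Semi-Riemannian geometry with applications to relativity*, Academic Press 1983,
  Ch. 2, Lemma 2.24–2.25; Ch. 3, Prop. 3.36, Lemma 3.52, pp. 60–61. [ONeill1983]
-/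

noncomputable section

set_option maxSynthPendingDepth 3

open Set Filter ContinuousLinearMap Module
open scoped Topology ContDiff

namespace Literature.Geometry.Lorentzian

namespace MetricCoord

/-! ### The algebra over `Fin 4` -/

section Algebra

/-- **Four-dimensional curvature algebra** (the pointwise core of Munteanu–Wang 2015, Prop. 1.1):
for `R : Fin 4 → Fin 4 → Fin 4 → Fin 4 → ℝ` skew-symmetric in its first pair and in its last pair
and symmetric under exchange of the pairs,
`Σ_{ijkl} R_{ijkl}² ≤ 16 Σ_{ik} (Σ_j R_{jikj})² + 16 Σ_{ijk} R_{ijk3}²`: the full tensor is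
controlled by its Ricci contraction and by the components with a slot equal to the distinguished
index `3` (in dimension three the Weyl tensor vanishes). Proof: normalise the `256` components to
the `21` independent ones and exhibit `16 · Ric² + 16 · Q − |R|²` as an explicit sum of squares.
[cite: MunteanuWang2015, Prop. 1.1] -/
theorem rm_sq_sum_le_fin_four (R : Fin 4 → Fin 4 → Fin 4 → Fin 4 → ℝ)
    (h₁ : ∀ i j k l, R i j k l = -R j i k l) (h₂ : ∀ i j k l, R i j k l = -R i j l k)
    (h₃ : ∀ i j k l, R i j k l = R k l i j) :
    ∑ i, ∑ j, ∑ k, ∑ l, R i j k l ^ 2 ≤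
      16 * ∑ i, ∑ k, (∑ j, R j i k j) ^ 2 + 16 * ∑ i, ∑ j, ∑ k, R i j k 3 ^ 2 := by
  -- normalisation of the components to the canonical `R i j k l`, `i < j`, `k < l`, `(i,j) ≤ (k,l)`
  have d0 : ∀ k l, R 0 0 k l = 0 := fun k l ↦ by linarith [h₁ 0 0 k l]
  have d1 : ∀ k l, R 1 1 k l = 0 := fun k l ↦ by linarith [h₁ 1 1 k l]
  have d2 : ∀ k l, R 2 2 k l = 0 := fun k l ↦ by linarith [h₁ 2 2 k l]
  have d3 : ∀ k l, R 3 3 k l = 0 := fun k l ↦ by linarith [h₁ 3 3 k l]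
  have e0 : ∀ i j, R i j 0 0 = 0 := fun i j ↦ by linarith [h₂ i j 0 0]
  have e1 : ∀ i j, R i j 1 1 = 0 := fun i j ↦ by linarith [h₂ i j 1 1]
  have e2 : ∀ i j, R i j 2 2 = 0 := fun i j ↦ by linarith [h₂ i j 2 2]
  have e3 : ∀ i j, R i j 3 3 = 0 := fun i j ↦ by linarith [h₂ i j 3 3]
  have a10 : ∀ k l, R 1 0 k l = -R 0 1 k l := fun k l ↦ h₁ 1 0 k l
  have a20 : ∀ k l, R 2 0 k l = -R 0 2 k l := fun k l ↦ h₁ 2 0 k l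
  have a30 : ∀ k l, R 3 0 k l = -R 0 3 k l := fun k l ↦ h₁ 3 0 k l
  have a21 : ∀ k l, R 2 1 k l = -R 1 2 k l := fun k l ↦ h₁ 2 1 k l
  have a31 : ∀ k l, R 3 1 k l = -R 1 3 k l := fun k l ↦ h₁ 3 1 k l
  have a32 : ∀ k l, R 3 2 k l = -R 2 3 k l := fun k l ↦ h₁ 3 2 k l
  have b10 : ∀ i j, R i j 1 0 = -R i j 0 1 := fun i j ↦ h₂ i j 1 0
  have b20 : ∀ i j, R i j 2 0 = -R i j 0 2 := fun i j ↦ h₂ i j 2 0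
  have b30 : ∀ i j, R i j 3 0 = -R i j 0 3 := fun i j ↦ h₂ i j 3 0
  have b21 : ∀ i j, R i j 2 1 = -R i j 1 2 := fun i j ↦ h₂ i j 2 1
  have b31 : ∀ i j, R i j 3 1 = -R i j 1 3 := fun i j ↦ h₂ i j 3 1
  have b32 : ∀ i j, R i j 3 2 = -R i j 2 3 := fun i j ↦ h₂ i j 3 2
  have c01 : R 0 2 0 1 = R 0 1 0 2 := h₃ 0 2 0 1
  have c02 : R 0 3 0 1 = R 0 1 0 3 := h₃ 0 3 0 1
  have c03 : R 1 2 0 1 = R 0 1 1 2 := h₃ 1 2 0 1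
  have c04 : R 1 3 0 1 = R 0 1 1 3 := h₃ 1 3 0 1
  have c05 : R 2 3 0 1 = R 0 1 2 3 := h₃ 2 3 0 1
  have c06 : R 0 3 0 2 = R 0 2 0 3 := h₃ 0 3 0 2
  have c07 : R 1 2 0 2 = R 0 2 1 2 := h₃ 1 2 0 2
  have c08 : R 1 3 0 2 = R 0 2 1 3 := h₃ 1 3 0 2
  have c09 : R 2 3 0 2 = R 0 2 2 3 := h₃ 2 3 0 2
  have c10 : R 1 2 0 3 = R 0 3 1 2 := h₃ 1 2 0 3
  have c11 : R 1 3 0 3 = R 0 3 1 3 := h₃ 1 3 0 3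
  have c12 : R 2 3 0 3 = R 0 3 2 3 := h₃ 2 3 0 3
  have c13 : R 1 3 1 2 = R 1 2 1 3 := h₃ 1 3 1 2
  have c14 : R 2 3 1 2 = R 1 2 2 3 := h₃ 2 3 1 2
  have c15 : R 2 3 1 3 = R 1 3 2 3 := h₃ 2 3 1 3
  simp only [Fin.sum_univ_four, d0, d1, d2, d3, e0, e1, e2, e3, a10, a20, a30, a21, a31, a32,
    b10, b20, b30, b21, b31, b32, c01, c02, c03, c04, c05, c06, c07, c08, c09, c10, c11, c12,
    c13, c14, c15]
  -- `16 Ric² + 16 Q − |R|²` is the following sum of squares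
  linarith [sq_nonneg (R 0 1 0 1 + R 0 2 0 2 + R 0 3 0 3 + R 1 2 1 2 + R 1 3 1 3 + R 2 3 2 3),
    sq_nonneg (R 0 1 0 1 - 2 * R 2 3 2 3), sq_nonneg (R 0 1 0 1), sq_nonneg (R 2 3 2 3),
    sq_nonneg (R 0 2 0 2 - 2 * R 1 3 1 3), sq_nonneg (R 0 2 0 2), sq_nonneg (R 1 3 1 3),
    sq_nonneg (R 1 2 1 2 - 2 * R 0 3 0 3), sq_nonneg (R 1 2 1 2), sq_nonneg (R 0 3 0 3),
    sq_nonneg (R 0 1 0 2 + 2 * R 1 3 2 3), sq_nonneg (R 0 1 0 2), sq_nonneg (R 1 3 2 3),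
    sq_nonneg (R 0 1 0 3 - R 1 2 2 3), sq_nonneg (R 0 1 0 3), sq_nonneg (R 1 2 2 3),
    sq_nonneg (R 0 1 1 2 - 2 * R 0 3 2 3), sq_nonneg (R 0 1 1 2), sq_nonneg (R 0 3 2 3),
    sq_nonneg (R 0 1 1 3 + R 0 2 2 3), sq_nonneg (R 0 1 1 3), sq_nonneg (R 0 2 2 3),
    sq_nonneg (R 0 2 0 3 + R 1 2 1 3), sq_nonneg (R 0 2 0 3), sq_nonneg (R 1 2 1 3),
    sq_nonneg (R 0 2 1 2 + 2 * R 0 3 1 3), sq_nonneg (R 0 2 1 2), sq_nonneg (R 0 3 1 3),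
    sq_nonneg (R 0 1 2 3), sq_nonneg (R 0 2 1 3), sq_nonneg (R 0 3 1 2)]

end Algebra

/-! ### Orthonormal bases with a prescribed last vector -/

section Adapted

variable {E : Type*} [NormedAddCommGroup E] [NormedSpace ℝ E] [FiniteDimensional ℝ E]
  {G : E → E →L[ℝ] E →L[ℝ] ℝ} {x : E}

/-- **An orthonormal basis with prescribed last vector**: for `G x` symmetric positive definite,
`dim E = n + 1` and a `G x`-unit vector `u` there is a `G x`-orthonormal basis `e` of `E`, indexed
by `Fin (n + 1)`, with `e (Fin.last n) = u` (O'Neill 1983, Ch. 2, Lemma 2.24–2.25: orthonormal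
sets extend to orthonormal bases). Proof: an orthonormal basis `e₀` of `(E, G x)`
(`exists_orthonormal_basis`) identifies it with Euclidean space, where the unit vector of the
coordinates of `u` extends to an orthonormal basis (Mathlib's
`Orthonormal.exists_orthonormalBasis_extension_of_card_eq`), whose image is the frame.
[cite: ONeill1983, Ch. 2, Lemma 2.24] -/
theorem exists_orthonormal_basis_last_eq (hs : ∀ v w, G x v w = G x w v)
    (hpos : ∀ v, v ≠ 0 → 0 < G x v v) {n : ℕ} (hn : finrank ℝ E = n + 1) {u : E}
    (hu : G x u u = 1) :
    ∃ e : Basis (Fin (n + 1)) ℝ E,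
      (∀ i j, G x (e i) (e j) = if i = j then 1 else 0) ∧ e (Fin.last n) = u := by
  classical
  obtain ⟨e₁, he₁⟩ := exists_orthonormal_basis hs hpos
  set e₀ : Basis (Fin (n + 1)) ℝ E := e₁.reindex (finCongr hn) with he₀def
  have he₀ : ∀ i j, G x (e₀ i) (e₀ j) = if i = j then 1 else 0 := fun i j ↦ by
    simp only [he₀def, Basis.reindex_apply, he₁, (finCongr hn).symm.injective.eq_iff]
  -- the coordinates of `u`, a unit vector of Euclidean space
  set û : EuclideanSpace ℝ (Fin (n + 1)) := WithLp.toLp 2 fun k ↦ G x u (e₀ k) with hûdef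
  have hû : ∀ k, û k = G x u (e₀ k) := fun k ↦ rfl
  have hûû : inner ℝ û û = (1 : ℝ) := by
    rw [← hu, apply_eq_sum_of_orthonormal e₀ he₀ hs u u, PiLp.inner_apply]
    refine Finset.sum_congr rfl fun k _ ↦ ?_
    rw [hû, real_inner_self_eq_norm_mul_norm, Real.norm_eq_abs, abs_mul_abs_self]
  have hv : Orthonormal ℝ (({Fin.last n} : Set (Fin (n + 1))).restrict
      fun _ : Fin (n + 1) ↦ û) := by
    rw [orthonormal_iff_ite]
    rintro ⟨i, hi⟩ ⟨j, hj⟩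
    rw [Set.mem_singleton_iff] at hi hj
    subst hi; subst hj
    rw [if_pos rfl]
    exact hûû
  obtain ⟨w, hw⟩ := hv.exists_orthonormalBasis_extension_of_card_eq
    (finrank_euclideanSpace (𝕜 := ℝ) (ι := Fin (n + 1)))
  -- the frame `fᵢ = Σ_k wᵢₖ e₀ₖ`
  set f : Fin (n + 1) → E := fun i ↦ ∑ k, (w i) k • e₀ k with hf
  have hGf : ∀ i v, G x (f i) v = ∑ k, (w i) k * G x (e₀ k) v := fun i v ↦ by
    simp only [hf, map_sum, map_smul, FunLike.coe_sum, Finset.sum_apply,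
      FunLike.coe_smul, Pi.smul_apply, smul_eq_mul]
  have hGf0 : ∀ i l, G x (f i) (e₀ l) = (w i) l := fun i l ↦ by
    rw [hGf]
    simp only [he₀, mul_ite, mul_one, mul_zero, Finset.sum_ite_eq', Finset.mem_univ, if_true]
  have horth : ∀ i j, G x (f i) (f j) = if i = j then 1 else 0 := by
    intro i j
    have h1 : G x (f i) (f j) = ∑ k, (w i) k * (w j) k := by
      rw [hs, hGf]
      refine Finset.sum_congr rfl fun k _ ↦ ?_
      rw [hs, hGf0]
      ring
    have h2 : (inner ℝ (w i) (w j) : ℝ) = ∑ k, (w i) k * (w j) k := by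
      rw [PiLp.inner_apply]
      refine Finset.sum_congr rfl fun k _ ↦ ?_
      simp [mul_comm]
    rw [h1, ← h2]
    exact orthonormal_iff_ite.mp w.orthonormal i j
  -- the last vector is `u`
  have hlast : f (Fin.last n) = u := by
    simp only [hf, hw (Fin.last n) (Set.mem_singleton _), hû]
    exact sum_apply_smul_of_orthonormal e₀ he₀ u
  -- `f` is a basis
  have hli : LinearIndependent ℝ f := by
    rw [Fintype.linearIndependent_iff]
    intro c hc i
    have h := congrArg (fun v ↦ G x v (f i)) hc
    simp only [map_sum, map_smul, FunLike.coe_sum, Finset.sum_apply, FunLike.coe_smul,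
      Pi.smul_apply, smul_eq_mul, horth, mul_ite, mul_one, mul_zero, Finset.sum_ite_eq',
      Finset.mem_univ, if_true, map_zero, _root_.zero_apply] at h
    exact h
  have hcard : Fintype.card (Fin (n + 1)) = finrank ℝ E := by rw [Fintype.card_fin, hn]
  have hspan : ⊤ ≤ Submodule.span ℝ (Set.range f) := (hli.span_eq_top_of_card_eq_finrank' hcard).ge
  refine ⟨Basis.mk hli hspan, fun i j ↦ ?_, ?_⟩
  · rw [Basis.coe_mk]; exact horth i j
  · rw [Basis.coe_mk]; exact hlast

/-- **An orthonormal basis adapted to a vector**: for `G x` symmetric positive definite and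
`dim E = n + 1`, every vector `Z` is `s • e (Fin.last n)` for some `G x`-orthonormal basis `e` and
some real `s` (normalise `Z` when `Z ≠ 0`; any orthonormal basis and `s = 0` otherwise).
[cite: ONeill1983, Ch. 2, Lemma 2.24] -/
theorem exists_orthonormal_basis_eq_smul_last (hs : ∀ v w, G x v w = G x w v)
    (hpos : ∀ v, v ≠ 0 → 0 < G x v v) {n : ℕ} (hn : finrank ℝ E = n + 1) (Z : E) :
    ∃ (e : Basis (Fin (n + 1)) ℝ E) (s : ℝ),
      (∀ i j, G x (e i) (e j) = if i = j then 1 else 0) ∧ Z = s • e (Fin.last n) := by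
  classical
  by_cases hZ : Z = 0
  · obtain ⟨e₁, he₁⟩ := exists_orthonormal_basis hs hpos
    refine ⟨e₁.reindex (finCongr hn), 0, fun i j ↦ ?_, by rw [hZ, zero_smul]⟩
    simp only [Basis.reindex_apply, he₁, (finCongr hn).symm.injective.eq_iff]
  · have hγ : 0 < G x Z Z := hpos Z hZ
    set r := Real.sqrt (G x Z Z) with hr
    have hr0 : 0 < r := Real.sqrt_pos.mpr hγ
    have hrr : r * r = G x Z Z := Real.mul_self_sqrt hγ.le
    have hu : G x (r⁻¹ • Z) (r⁻¹ • Z) = 1 := by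
      simp only [map_smul, FunLike.coe_smul, Pi.smul_apply, smul_eq_mul, ← hrr]
      field_simp
    obtain ⟨e, he, hel⟩ := exists_orthonormal_basis_last_eq hs hpos hn hu
    refine ⟨e, r, he, ?_⟩
    rw [hel, smul_smul, mul_inv_cancel₀ hr0.ne', one_smul]

end Adapted

/-! ### The curvature estimate on a four-dimensional gradient soliton -/

section Soliton

variable {E : Type*} [NormedAddCommGroup E] [NormedSpace ℝ E] [FiniteDimensional ℝ E]
  [CompleteSpace E] {G : E → E →L[ℝ] E →L[ℝ] ℝ} {V : Set E} {x : E} {f : E → ℝ} {lam : ℝ}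

/-- **Munteanu–Wang 2015, Prop. 1.1 (pointwise form): on a four-dimensional gradient Ricci
soliton `|∇f|² |Rm|² ≤ 16 |∇f|² |Ric|² + 64 |∇Ric|²`.** For metric components `G` with
`Ric + Hess f = λ G` on `V`, `dim E = 4`, `G x` positive definite, and any basis `b`:
`|∇Ric|²_x = Σ_{kl} g^{kl} ⟨∇_{b_k}Ric, ∇_{b_l}Ric⟩_G ≥ 0` and
`|∇f|²_x |Rm|²_x ≤ 16 |∇f|²_x |Ric|²_x + 64 |∇Ric|²_x`. In a `G x`-orthonormal frame `e` with
`♯Df = s e₃` (`exists_orthonormal_basis_eq_smul_last`; `s² = |∇f|²`) the soliton identity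
`(∇_W Ric)(Y,Z) − (∇_Y Ric)(W,Z) = Df(R(W,Y)Z)` (`IsMetricOn.cov₂At_ricAt_sub_of_soliton`;
Munteanu–Wang's `R_{ijkl} f_l = ∇_j R_{ik} − ∇_i R_{jk}`, p. 4) reads
`s R_{aci3} = (∇_{e_a}Ric)(e_c,e_i) − (∇_{e_c}Ric)(e_a,e_i)`, whence
`s² Σ_{aci} R_{aci3}² ≤ 4 |∇Ric|²` (`IsMetricOn.covNormSq_ricAt_eq_sum_frame`); the rest is the
algebra `rm_sq_sum_le_fin_four` for the components `R_{acij} = G(R(e_a,e_c)e_i, e_j)`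
(`IsMetricOn.rmNormSqAt_eq_sum_sq`, `ricAt_eq_sum_of_orthonormal`, `normSqAt_eq_sum_frame`).
[cite: MunteanuWang2015, Prop. 1.1] -/
theorem IsMetricOn.gradSqAt_mul_rmNormSqAt_le_of_soliton (b : Basis (Fin 4) ℝ E)
    (hG : IsMetricOn G V) (hx : x ∈ V) (hE : finrank ℝ E = 4)
    (hpos : ∀ v : E, v ≠ 0 → 0 < G x v v) (hf : ContDiffOn ℝ ∞ f V)
    (hsol : ∀ y ∈ V, ∀ v w, ricAt G y v w + hessAt G f y v w = lam * G y v w) :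
    0 ≤ ∑ k, ∑ l, ginv G b x k l *
        pairAt G x (cov₂At G (ricAt G) x (b k)) (cov₂At G (ricAt G) x (b l)) ∧
      gradSqAt G f x * rmNormSqAt G x ≤
        16 * gradSqAt G f x * normSqAt G x (ricAt G x) + 64 * ∑ k, ∑ l, ginv G b x k l *
          pairAt G x (cov₂At G (ricAt G) x (b k)) (cov₂At G (ricAt G) x (b l)) := by
  classical
  have hi := hG.isInvertible x hx
  have hs := hG.symm x hx
  -- an orthonormal frame adapted to the gradient: `♯Df = s • e 3`
  obtain ⟨e, s, he, hZ⟩ :=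
    exists_orthonormal_basis_eq_smul_last hs hpos (n := 3) hE (sharpAt G x (fderiv ℝ f x))
  have h3 : (Fin.last 3 : Fin 4) = 3 := rfl
  rw [h3] at hZ
  have hDf : ∀ w, fderiv ℝ f x w = s * G x w (e 3) := fun w ↦ by
    rw [← apply_sharpAt_apply hi (fderiv ℝ f x) w, hZ, map_smul, hs]
    simp only [FunLike.coe_smul, Pi.smul_apply, smul_eq_mul]
  -- the components of `Rm` and `∇Ric` in the frame
  obtain ⟨Rm, hRm⟩ : ∃ Rm : Fin 4 → Fin 4 → Fin 4 → Fin 4 → ℝ,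
      ∀ a c i j, Rm a c i j = G x (riemAt G x (e a) (e c) (e i)) (e j) := ⟨_, fun _ _ _ _ ↦ rfl⟩
  obtain ⟨C, hC⟩ : ∃ C : Fin 4 → Fin 4 → Fin 4 → ℝ,
      ∀ k i j, C k i j = cov₂At G (ricAt G) x (e k) (e i) (e j) := ⟨_, fun _ _ _ ↦ rfl⟩
  -- (1) `|∇Ric|² = Σ C²`, `|Rm|² = Σ Rm²`, `|Ric|² = Σ_{ik} (Σ_j Rm_{jikj})²`, `|∇f|² = s²`
  have hN : ∑ k, ∑ l, ginv G b x k l *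
      pairAt G x (cov₂At G (ricAt G) x (b k)) (cov₂At G (ricAt G) x (b l)) =
      ∑ k, ∑ i, ∑ j, C k i j ^ 2 := by
    rw [hG.covNormSq_ricAt_eq_sum_frame b hx e he]
    simp only [hC]
  have hRmN : rmNormSqAt G x = ∑ a, ∑ c, ∑ i, ∑ j, Rm a c i j ^ 2 := by
    rw [hG.rmNormSqAt_eq_sum_sq e he hx]
    simp only [hRm]
  have hRic : normSqAt G x (ricAt G x) = ∑ i, ∑ k, (∑ j, Rm j i k j) ^ 2 := by
    rw [normSqAt_eq_sum_frame e he hi hs]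
    simp only [ricAt_eq_sum_of_orthonormal e he, hRm]
  have hγ : gradSqAt G f x = s ^ 2 := by
    rw [gradSqAt_apply, hDf, hZ, map_smul]
    simp only [FunLike.coe_smul, Pi.smul_apply, smul_eq_mul, he, if_true]
    ring
  -- (2) the symmetries of `Rm` and the algebra over `Fin 4`
  have hsk₁ : ∀ i j k l, Rm i j k l = -Rm j i k l := fun i j k l ↦ by
    simp only [hRm, riemAt_swap G x (e i) (e j), _root_.neg_apply, map_neg, neg_neg]
  have hsk₂ : ∀ i j k l, Rm i j k l = -Rm i j l k := fun i j k l ↦ by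
    simp only [hRm]
    exact hG.apply_riemAt_swap hx (e i) (e j) (e l) (e k)
  have hpair : ∀ i j k l, Rm i j k l = Rm k l i j := fun i j k l ↦ by
    simp only [hRm]
    exact hG.apply_riemAt_pair_comm hx (e i) (e j) (e k) (e l)
  have halg := rm_sq_sum_le_fin_four Rm hsk₁ hsk₂ hpair
  -- (3) the soliton identity `s Rm_{aci3} = C_{aci} − C_{cai}` and `s² Q ≤ 4 |∇Ric|²`
  have hsolR : ∀ a c i, s * Rm a c i 3 = C a c i - C c a i := fun a c i ↦ by
    have h := hG.cov₂At_ricAt_sub_of_soliton hx hf hsol (e a) (e c) (e i)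
    rw [hDf] at h
    rw [hC, hC, hRm, h]
  have hkey : s ^ 2 * ∑ i, ∑ j, ∑ k, Rm i j k 3 ^ 2 ≤ 4 * ∑ k, ∑ i, ∑ j, C k i j ^ 2 := by
    have h1 : s ^ 2 * ∑ i, ∑ j, ∑ k, Rm i j k 3 ^ 2 = ∑ i, ∑ j, ∑ k, (C i j k - C j i k) ^ 2 := by
      rw [Finset.mul_sum]
      refine Finset.sum_congr rfl fun i _ ↦ ?_
      rw [Finset.mul_sum]
      refine Finset.sum_congr rfl fun j _ ↦ ?_
      rw [Finset.mul_sum]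
      refine Finset.sum_congr rfl fun k _ ↦ ?_
      rw [← hsolR]
      ring
    have h2 : ∑ i, ∑ j, ∑ k, C j i k ^ 2 = ∑ i, ∑ j, ∑ k, C i j k ^ 2 := Finset.sum_comm
    have h4 : ∑ i, ∑ j, ∑ k, (C i j k - C j i k) ^ 2 ≤
        ∑ i, ∑ j, ∑ k, (2 * C i j k ^ 2 + 2 * C j i k ^ 2) :=
      Finset.sum_le_sum fun i _ ↦ Finset.sum_le_sum fun j _ ↦ Finset.sum_le_sum fun k _ ↦ by
        nlinarith [sq_nonneg (C i j k + C j i k)]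
    have h5 : ∑ i, ∑ j, ∑ k, (2 * C i j k ^ 2 + 2 * C j i k ^ 2) =
        2 * ∑ i, ∑ j, ∑ k, C i j k ^ 2 + 2 * ∑ i, ∑ j, ∑ k, C j i k ^ 2 := by
      simp only [Finset.sum_add_distrib, Finset.mul_sum]
    rw [h1]
    linarith [h4, h5, h2]
  -- (4) conclusion
  refine ⟨?_, ?_⟩
  · rw [hN]
    positivity
  · rw [hN, hRmN, hRic, hγ]
    have hmul := mul_le_mul_of_nonneg_left halg (sq_nonneg s)
    linarith [hmul, hkey]

end Soliton

end MetricCoord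

end Literature.Geometry.Lorentzian

end
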